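import Summits.RiemannHypothesis.RiemannHypothesis.Theorems.TiltedLandingLaw421R3Lens1ArcSignI
import Summits.RiemannHypothesis.RiemannHypothesis.Theorems.TiltedLandingLaw421R3RateSkeleton

/-! # trkD_v12q DRAFT-1 — FACTS sheet (lens-2 g7, O7-d): kernel certificates for the docstring claims of `trkD_v12q-DRAFT-1.lean` (scratch; 0 sorry)
(F-i)  the ∃-budget stubs are EQUIVALENT to v11qʼs canonical stubs;
(F-i′) the «canonical + `BddAbove` binder» variant is VACUOUS (provable outright);
(F-ii) ★A at the canonical budgets is the weakest ★A an admissible budget pair yields; the `∀ aR aC` relative form would imply ★A at EVERY larger budget;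
(F-iii) the SUCC residual stub is equivalent to `TopPinning`;
(F-iv) the four RATE stubs of DRAFT-1 are JOINTLY equivalent to `RateLawsHalfQ` (nothing weakened, nothing strengthened vs v11q).
Nothing here bears on the truth of RH; RH is not proved; checked ≠ landed ≠ proved. -/

namespace RhW08.Lens2V12QFacts

open RhW08.Round1 RhW08.StSwap RhW08.Round2 RhW08.QuadW
open RhW08.SealSwap (PBot)
open RhW08.SealSwapQ RhW08.RateSplit RhW08.BurgersRate RhW08.BurgersRateG3 RhW08.Lens1Pinning RhW08.Lens1ArcSign
open RhIdea6.G17.W07C7 RhIdea6.G17.W07C7.Rev6 RhIdea6.G18.W07C8.Law421BirthS RhIdea6.G19.W07C11.Seam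
open RhIdea6.G20.W07C12.Frac RhIdea6.G20.W07C12.StColP RhW07.C12.FieldSplit RhIdea6.G21.W07C13.TentMax
open RhW07.C14.TwoSided RhW07.C14.Classes RhW07.C14.Lineage RhW07.C14.Booking

/-- (F-i) rise socket: ∃-form ⟺ canonical form. -/
theorem energyRiseEx_iff_canonical : (∃ aR : Budget, EnergyRiseLawQ aR) ↔ EnergyRiseLawQ riseSupQ :=
  ⟨fun ⟨_, h⟩ => energyRiseLawQ_canonical h, fun h => ⟨riseSupQ, h⟩⟩

/-- (F-i) consumption socket: ∃-form ⟺ canonical form. -/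
theorem consEx_iff_canonical : (∃ aC : Budget, ConsLawQ aC) ↔ ConsLawQ consSupQ :=
  ⟨fun ⟨_, h⟩ => consLawQ_canonical h, fun h => ⟨consSupQ, h⟩⟩

/-- (F-i′) the `BddAbove`-guarded canonical rise law is a TAUTOLOGY (`le_csSup`): it carries no content and must not be typed as a stub. -/
theorem energyRiseLaw_canonical_of_bddAbove (η : ℝ) (f : ℂ → ℂ) (x₀ s hmax R Hs : ℝ) (B : ℕ)
    (hb : BddAbove ((fun k : ℕ => energyRiseSumQ η f x₀ s hmax R Hs B (k + 1)) ''
      {k : ℕ | Charged (PTrkSQ PBot) StTrkDQ ReadyR2 η f x₀ s hmax R Hs B k}))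
    (k : ℕ) (hk : Charged (PTrkSQ PBot) StTrkDQ ReadyR2 η f x₀ s hmax R Hs B k) :
    energyRiseSumQ η f x₀ s hmax R Hs B (k + 1) ≤ riseSupQ η f x₀ s hmax R Hs B :=
  le_csSup hb ⟨k, hk, rfl⟩

/-- (F-ii) ★A at the canonical budgets follows from ★A at ANY admissible pair (tree `approachAllowanceQ_canonical`, restated). -/
theorem approachC_canonical_weakest {aR aC : Budget} (hR : EnergyRiseLawQ aR) (hC : ConsLawQ aC)
    (hA : ApproachAllowanceQ (approachBudgetHalfQ aR aC)) : ApproachAllowanceQ (approachBudgetHalfQ riseSupQ consSupQ) :=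
  approachAllowanceQ_canonical hR hC hA

/-- (F-ii) why the RELATIVE `∀ aR aC` typing is not offered: it would give ★A at the canonical budgets PLUS ANY non-negative constant surcharge `t`
(budgets are only asked to be upper bounds, so `aR + t` is admissible whenever `aR` is) — an allowance unbounded below. -/
theorem approach_forall_form_too_strong
    (h : ∀ aR aC : Budget, EnergyRiseLawQ aR → ConsLawQ aC → ApproachAllowanceQ (approachBudgetHalfQ aR aC))
    {aR aC : Budget} (hR : EnergyRiseLawQ aR) (hC : ConsLawQ aC) (t : ℝ) (ht : 0 ≤ t) :
    ApproachAllowanceQ (approachBudgetHalfQ (fun η f x₀ s hmax R Hs B => aR η f x₀ s hmax R Hs B + t) aC) :=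
  h _ _ (energyRiseLawQ_mono (fun η f x₀ s hmax R Hs B => by linarith) hR) hC

/-- (F-iii) the SUCC residual stub ⟺ `TopPinning` (tree Iff, by name). -/
theorem residual_iff_topPinning : TopPinningNonNestedAscResidual ↔ TopPinning :=
  topPinning_iff_nonNestedAscResidual.symm

/-- (F-iv) the four RATE stubs of DRAFT-1 are JOINTLY EQUIVALENT to the registered rate door `RateLawsHalfQ`. -/
theorem rateStubs_iff_rateLawsHalfQ :
    (FarEnergyLawCQ (4 / 5) ∧ (∃ aR : Budget, EnergyRiseLawQ aR) ∧ (∃ aC : Budget, ConsLawQ aC) ∧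
      ApproachAllowanceQ (approachBudgetHalfQ riseSupQ consSupQ)) ↔ RhW08.RateSplit.RateLawsHalfQ := by
  rw [rateLawsHalfQ_iff_canonical, energyRiseEx_iff_canonical, consEx_iff_canonical]

end RhW08.Lens2V12QFacts
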